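import Literature.NumberTheory.EllipticCurves.IntSeriesIdentityPrincipleTorsion
import Literature.NumberTheory.EllipticCurves.IntSeriesNodeTransportNoUnitContent
import Literature.NumberTheory.EllipticCurves.IntSeriesOnePlusPowExponentLaws
import Literature.NumberTheory.EllipticCurves.IntSeriesOnePlusPowMul
import Literature.NumberTheory.EllipticCurves.DeShalit1987.KatzMeasureTwistedLines
import Literature.NumberTheory.EllipticCurves.DeShalit1987.KatzMeasureMonomialLines
import HarnessLib

/-!
# Rigidity of `𝒪_{ℂ_p}⟦T₁⟧⟦T₂⟧` from values on the set `{(uᵗ − 1, ζ − 1)}` (nodes × torsion points):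
# proportional values `G'(·) = c·dᵗ·G(·)` force `d = u^z`, `G' = c·(1+T₁)^z·G`, hence `(G') = (G)` (PROVED)

Topic `Literature/NumberTheory/EllipticCurves`, namespace `Literature.NumberTheory.EllipticCurves.IntSeries`.
THEOREMS ONLY (no definition, no named fact, no `sorry`, no `instance`).

THE SITUATION. `G, G' ∈ 𝒪_{ℂ_p}⟦T₁⟧⟦T₂⟧` (`G ≠ 0`), a one-unit `u ∈ ℂ_p` which is not a root of unity,
and constants `c, d ∈ ℂ_pˣ` such that at every point `(uᵗ − 1, ζ − 1)` — `t ∈ ℕ`, `ζ` a primitive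
`pⁿ`-th root of unity of any level `n > n₀` — the values are proportional:
`G'(uᵗ − 1, ζ − 1) = c · dᵗ · G(uᵗ − 1, ζ − 1)`. This is the shape of de Shalit's two-variable
interpolation on the infinity types `(−m, 0)` (`IsKatzMeasure₂₀`, de Shalit 1987 II.4.12 (31) / II.4.17
(54) at `j = 0`) for two solutions at two period triples: along `γ₁` (inertia at `v`, `p`-adic weight
`−m`) the points are the nodes `uᵗ − 1` of a one-unit, along `γ₂` (inertia at `v̄`, weight `0`) only the
torsion points `ζ − 1` occur, and the two prescribed values differ by `A^{m₀ + 2t}` (`A` the period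
ratio). CONCLUSIONS:

* §1 (algebra of the outer twist) `lineSubst_C_mul` (`lineSubst c (C U · Φ) = U · lineSubst c Φ` for
  `U ∈ 𝒪⟦T⟧` acting on the inner variable), `transpose_C_mul` (`(C U · Φ)ᵗ = U(T₁) · Φᵗ`, `U(T₁) = U.map C`),
  `onePlusPow_pow_sub_one` (`(uᵗ)^z = (u^z)ᵗ`), `hasValueAt_C_mul_binomPow` (+ private node helpers).
* §2 ★ `exists_onePlusPow_eq_of_torsion_nodes` — `d = u^z` for some `z ∈ ℤ_p` (in particular `‖d‖ = 1`):
  some line `T₂ = ζ₀ − 1` of `G` has a non-zero node value (else `G = 0` by the torsion/closed-disc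
  principle `eq_zero_of_zeros₂_fibred_torsion`), and the dense-valued node transport
  (`map_eq_C_mul_binomPow_mul_of_values_proportional`) on that line identifies `d`.
* §3 ★★ `eq_map_C_mul_binomPow_mul_of_torsion_nodes` — if moreover `c ∈ 𝒪_{ℂ_p}`:
  `G' = (c·(1+T)^z)(T₁) · G` in `𝒪_{ℂ_p}⟦T₁⟧⟦T₂⟧` (the transposed difference vanishes at every point of the
  set — one-variable multiplicativity of values on each line `T₂ = ζ − 1` — hence is `0` by
  `eq_zero_of_zeros₂_torsion_fst`); ★★ `span_eq_span_of_torsion_nodes` — if `‖c‖ = 1`: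
  `Ideal.span {G'} = Ideal.span {G}`.

What is NOT here: the character supply realising this point set on a concrete frame (the `j = 0` seed,
the type-`(w,0)` character, the finite characters through the pair) — that is the arithmetic input of
each application (cell bsd-print-cf2, `Theorems/…KatzPeriodRigidityJZero`).

## References

* [deShalit1987] E. de Shalit, *Iwasawa theory of elliptic curves with complex multiplication* (1987),
  II.4.12 Remarks (iii)–(iv) (p. 66–67), II.4.16 (49)–(50) (p. 76–77), II.4.17 (51)–(54) (p. 77–78).
* [Gouvea1993PadicNumbers] F. Q. Gouvêa, *p-adic Numbers*, §5.9 Lemma 5.9.1 and Problem 194 (the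
  binomial twist along nodes), §5.6 Cor. 5.6.4.
* [Washington1997] L. C. Washington, *Introduction to Cyclotomic Fields*, §12.2, §7.2.
* [Koblitz1984] N. Koblitz, *p-adic Numbers, p-adic Analysis, and Zeta-Functions*, Ch. IV §1.
-/

noncomputable section

open scoped Classical
open Filter Topology PowerSeries Finset

namespace Literature.NumberTheory.EllipticCurves.IntSeries

variable {p : ℕ} [Fact p.Prime]

/-! ### §1. Algebra: a series in the inner variable `T₁` twisting the outer one -/

/-- **Lines commute with inner-constant multipliers**: for `U ∈ 𝒪⟦T⟧` (a series in the INNER variable)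
and `‖c‖ < 1`, `lineSubst c (C U · Φ) = U · lineSubst c Φ` (only finite antidiagonal sums are exchanged
with the convergent line sums). [cite: deShalit1987, II.4.17 (51)–(54) (p. 77–78)] -/
theorem lineSubst_C_mul (Φ : PowerSeries (PowerSeries (PadicComplexInt p)))
    (U : PowerSeries (PadicComplexInt p)) {c : PadicComplexInt p} (hc : ‖(c : ℂ_[p])‖ < 1) :
    lineSubst c (PowerSeries.C U * Φ) = U * lineSubst c Φ := by
  ext k
  -- both sides read in `ℂ_p`
  have hterm : ∀ i : ℕ,
      ((PowerSeries.coeff k (PowerSeries.coeff i (PowerSeries.C U * Φ)) : PadicComplexInt p) : ℂ_[p]) *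
          (c : ℂ_[p]) ^ i =
        ∑ ab ∈ antidiagonal k, ((PowerSeries.coeff ab.1 U : PadicComplexInt p) : ℂ_[p]) *
          (((PowerSeries.coeff ab.2 (PowerSeries.coeff i Φ) : PadicComplexInt p) : ℂ_[p]) *
            (c : ℂ_[p]) ^ i) := by
    intro i
    rw [PowerSeries.coeff_C_mul, PowerSeries.coeff_mul, AddSubmonoidClass.coe_finsetSum, sum_mul]
    refine sum_congr rfl fun ab _ ↦ ?_
    rw [MulMemClass.coe_mul]
    ring
  have hsum : ∀ ab ∈ antidiagonal k, Summable fun i : ℕ ↦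
      ((PowerSeries.coeff ab.1 U : PadicComplexInt p) : ℂ_[p]) *
        (((PowerSeries.coeff ab.2 (PowerSeries.coeff i Φ) : PadicComplexInt p) : ℂ_[p]) *
          (c : ℂ_[p]) ^ i) :=
    fun ab _ ↦ (summable_coeff_mul_pow Φ hc ab.2).mul_left _
  calc ((PowerSeries.coeff k (lineSubst c (PowerSeries.C U * Φ)) : PadicComplexInt p) : ℂ_[p])
      = ∑' i : ℕ, ((PowerSeries.coeff k (PowerSeries.coeff i (PowerSeries.C U * Φ)) :
          PadicComplexInt p) : ℂ_[p]) * (c : ℂ_[p]) ^ i := coe_coeff_lineSubst _ c k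
    _ = ∑' i : ℕ, ∑ ab ∈ antidiagonal k, ((PowerSeries.coeff ab.1 U : PadicComplexInt p) : ℂ_[p]) *
          (((PowerSeries.coeff ab.2 (PowerSeries.coeff i Φ) : PadicComplexInt p) : ℂ_[p]) *
            (c : ℂ_[p]) ^ i) := tsum_congr hterm
    _ = ∑ ab ∈ antidiagonal k, ∑' i : ℕ, ((PowerSeries.coeff ab.1 U : PadicComplexInt p) : ℂ_[p]) *
          (((PowerSeries.coeff ab.2 (PowerSeries.coeff i Φ) : PadicComplexInt p) : ℂ_[p]) *
            (c : ℂ_[p]) ^ i) := Summable.tsum_finsetSum hsum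
    _ = ∑ ab ∈ antidiagonal k, ((PowerSeries.coeff ab.1 U : PadicComplexInt p) : ℂ_[p]) *
          ((PowerSeries.coeff ab.2 (lineSubst c Φ) : PadicComplexInt p) : ℂ_[p]) := by
        refine sum_congr rfl fun ab _ ↦ ?_
        rw [tsum_mul_left, coe_coeff_lineSubst]
    _ = ((PowerSeries.coeff k (U * lineSubst c Φ) : PadicComplexInt p) : ℂ_[p]) := by
        rw [PowerSeries.coeff_mul, AddSubmonoidClass.coe_finsetSum]
        refine sum_congr rfl fun ab _ ↦ ?_
        rw [MulMemClass.coe_mul]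

/-- **Transposition turns the inner-constant multiplier into an outer twist**:
`(C U · Φ)ᵗ = U(T₁) · Φᵗ` with `U(T₁) = U.map C` (the series `U` read in the OUTER variable).
[cite: deShalit1987, II.4.17 (51)–(54) (p. 77–78)] -/
theorem transpose_C_mul (Φ : PowerSeries (PowerSeries (PadicComplexInt p)))
    (U : PowerSeries (PadicComplexInt p)) :
    transpose (PowerSeries.C U * Φ) =
      U.map (PowerSeries.C (R := PadicComplexInt p)) * transpose Φ := by
  refine PowerSeries.ext fun i ↦ PowerSeries.ext fun j ↦ ?_
  rw [coeff_coeff_transpose (PowerSeries.C U * Φ) i j, PowerSeries.coeff_C_mul, PowerSeries.coeff_mul,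
    PowerSeries.coeff_mul]
  simp only [map_sum, PowerSeries.coeff_map, PowerSeries.coeff_C_mul, coeff_coeff_transpose]

/-- `(uᵗ)^z = (u^z)ᵗ` for a one-unit `u`, read through `onePlusPow` at `uᵗ − 1` and `u − 1`.
[cite: Koblitz1984, Ch. IV §1] -/
theorem onePlusPow_pow_sub_one (z : ℤ_[p]) {u : ℂ_[p]} (hu : ‖u - 1‖ < 1) (t : ℕ) :
    onePlusPow z (u ^ t - 1) = onePlusPow z (u - 1) ^ t := by
  induction t with
  | zero => rw [pow_zero, sub_self, onePlusPow_at_zero, pow_zero]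
  | succ t ih => rw [onePlusPow_pow_succ_sub_one z hu t, ih, pow_succ]

/-- The value of `c · (1+T)^z` at `y` (`‖y‖ < 1`) is `c · (1+y)^z`. [cite: Koblitz1984, Ch. IV §1] -/
theorem hasValueAt_C_mul_binomPow (c : PadicComplexInt p) (z : ℤ_[p]) {y : ℂ_[p]} (hy : ‖y‖ < 1) :
    IntSeries.HasValueAt (PowerSeries.C c * binomPow z) y ((c : ℂ_[p]) * onePlusPow z y) := by
  have h := hasValueAt_of_unit_binomPow (F := 1) (F' := PowerSeries.C c * binomPow z) (z := z) (c₀ := c)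
    (by rw [mul_one]) hy (v := 1) ?_
  · simpa using h
  · unfold IntSeries.HasValueAt
    have : (fun k : ℕ ↦ ((PowerSeries.coeff k (1 : PowerSeries (PadicComplexInt p)) : PadicComplexInt p) :
        ℂ_[p]) * y ^ k) = fun k ↦ if k = 0 then (1 : ℂ_[p]) else 0 := by
      funext k
      rw [PowerSeries.coeff_one]
      split_ifs with hk <;> simp [hk]
    rw [this]
    exact hasSum_ite_eq 0 _

/-- `‖uᵗ − 1‖ ≤ ‖u − 1‖` for a one-unit `u` (`uᵗ − 1 = (u − 1)(1 + u + ⋯ + u^{t−1})`). [folklore] -/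
private theorem norm_pow_sub_one_le {u : ℂ_[p]} (hu : ‖u - 1‖ < 1) (t : ℕ) : ‖u ^ t - 1‖ ≤ ‖u - 1‖ := by
  have hu1 : ‖u‖ = 1 := by
    have hh := IsUltrametricDist.norm_add_eq_max_of_norm_ne_norm (x := u - 1) (y := (1 : ℂ_[p]))
      (by rw [norm_one]; exact hu.ne)
    rw [sub_add_cancel, norm_one] at hh
    rw [hh]
    exact max_eq_right hu.le
  rw [← geom_sum_mul, norm_mul]
  refine mul_le_of_le_one_left (norm_nonneg _) ?_
  refine IsUltrametricDist.norm_sum_le_of_forall_le_of_nonneg zero_le_one fun i _ ↦ ?_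
  rw [norm_pow, hu1, one_pow]

/-- The nodes `uᵗ − 1` of a one-unit which is not a root of unity are pairwise distinct, so the
elements of `𝒪_{ℂ_p}` of that form are an infinite set (inside the closed disc of radius `‖u − 1‖`). [folklore] -/
private theorem infinite_setOf_node {u : ℂ_[p]} (hu : ‖u - 1‖ < 1) (hroot : ∀ n : ℕ, 0 < n → u ^ n ≠ 1) :
    {y : PadicComplexInt p | ∃ t : ℕ, (y : ℂ_[p]) = u ^ t - 1}.Infinite := by
  have hu0 : u ≠ 0 := by
    rintro rfl
    rw [zero_sub, norm_neg, norm_one] at hu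
    exact lt_irrefl _ hu
  -- `t ↦ uᵗ` is injective
  have hinj : ∀ s d : ℕ, u ^ s = u ^ (s + d) → d = 0 := by
    intro s d hsd
    by_contra hd
    apply hroot d (Nat.pos_of_ne_zero hd)
    rw [pow_add] at hsd
    exact mul_left_cancel₀ (pow_ne_zero _ hu0) (hsd.symm.trans (mul_one _).symm)
  let g : ℕ → PadicComplexInt p := fun t ↦
    ⟨u ^ t - 1, mem_padicComplexInt_iff.mpr ((norm_pow_sub_one_le hu t).trans hu.le)⟩
  have hg : Function.Injective g := by
    intro s t hst
    have hst' : u ^ s - 1 = u ^ t - 1 := congrArg Subtype.val hst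
    have hst'' : u ^ s = u ^ t := sub_left_injective hst'
    rcases le_total s t with hle | hle
    · obtain ⟨d, rfl⟩ := Nat.exists_eq_add_of_le hle
      rw [hinj s d hst'', Nat.add_zero]
    · obtain ⟨d, rfl⟩ := Nat.exists_eq_add_of_le hle
      rw [hinj t d hst''.symm, Nat.add_zero]
  exact (Set.infinite_range_of_injective hg).mono (by rintro y ⟨t, rfl⟩; exact ⟨t, rfl⟩)

/-! ### §2. The ratio along the nodes is `u^z` -/

/-- **The node ratio is a `ℤ_p`-power of the node base.** Let `G ≠ 0`, `G'` in `𝒪_{ℂ_p}⟦T₁⟧⟦T₂⟧`, `u` a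
one-unit of `ℂ_p` which is not a root of unity, `c, d ≠ 0`, and suppose `G'(uᵗ − 1, ζ − 1) = c·dᵗ·G(uᵗ − 1, ζ − 1)`
for every `t` and every primitive `pⁿ`-th root of unity `ζ` of every level `n > n₀`. Then `d = u^z`
(`= onePlusPow z (u − 1)`) for some `z ∈ ℤ_p`. Proof: some such point carries a non-zero value of `G`
(else `G = 0`, `eq_zero_of_zeros₂_fibred_torsion`); on its line `T₂ = ζ₀ − 1` the node values of the two
lines are proportional by `c·dᵗ`, and the node transport `map_eq_C_mul_binomPow_mul_of_values_proportional`
identifies `d`. [cite: deShalit1987, II.4.12 Remarks (iii)–(iv) (p. 66–67), II.4.17 (54) (p. 78)]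
[cite: Gouvea1993PadicNumbers, §5.9 Lemma 5.9.1 and Problem 194] -/
theorem exists_onePlusPow_eq_of_torsion_nodes {G G' : PowerSeries (PowerSeries (PadicComplexInt p))}
    {u c d : ℂ_[p]} (hu : ‖u - 1‖ < 1) (hroot : ∀ n : ℕ, 0 < n → u ^ n ≠ 1) (hc : c ≠ 0) (hd : d ≠ 0)
    (n₀ : ℕ)
    (h : ∀ (t n : ℕ) (ζ : ℂ_[p]), n₀ < n → IsPrimitiveRoot ζ (p ^ n) →
      ∃ x : ℂ_[p], IntSeries.HasValueAt₂ G (u ^ t - 1) (ζ - 1) x ∧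
        IntSeries.HasValueAt₂ G' (u ^ t - 1) (ζ - 1) (c * d ^ t * x))
    (hG0 : G ≠ 0) : ∃ z : ℤ_[p], d = onePlusPow z (u - 1) := by
  have hu1 : u ≠ 1 := fun h1 ↦ hroot 1 Nat.one_pos (by rw [pow_one, h1])
  have hϖ0 : u - 1 ≠ 0 := sub_ne_zero.mpr hu1
  -- a point of the set with a non-zero value of `G`
  obtain ⟨t₀, n₁, ζ₀, x₀, hn₁, hζ₀, hx₀, hx₀0⟩ : ∃ (t₀ n₁ : ℕ) (ζ₀ x₀ : ℂ_[p]), n₀ < n₁ ∧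
      IsPrimitiveRoot ζ₀ (p ^ n₁) ∧ IntSeries.HasValueAt₂ G (u ^ t₀ - 1) (ζ₀ - 1) x₀ ∧ x₀ ≠ 0 := by
    by_contra hne
    push Not at hne
    apply hG0
    refine eq_zero_of_zeros₂_fibred_torsion hϖ0 hu (infinite_setOf_node hu hroot) ?_ ?_
    · rintro c ⟨t, ht⟩
      rw [ht]
      exact norm_pow_sub_one_le hu t
    · rintro c ⟨t, ht⟩
      refine ⟨n₀, fun n ζ hn hζ ↦ ?_⟩
      obtain ⟨x, hx, -⟩ := h t n ζ hn hζ
      have hx0 : x = 0 := hne t n ζ x hn hζ hx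
      rw [ht]
      simpa [hx0] using hx
  -- the node values on the line `T₂ = ζ₀ − 1`
  choose x hx hx' using fun t ↦ h t n₁ ζ₀ hn₁ hζ₀
  have hζ₀1 : ‖ζ₀ - 1‖ < 1 := norm_sub_one_lt_one_of_isPrimitiveRoot_pow hζ₀
  set a : PadicComplexInt p := ⟨ζ₀ - 1, mem_padicComplexInt_iff.mpr hζ₀1.le⟩ with ha
  have ha' : ‖(a : ℂ_[p])‖ < 1 := hζ₀1
  have hnode : ∀ t : ℕ, ‖u ^ t - 1‖ < 1 := fun t ↦ (norm_pow_sub_one_le hu t).trans_lt hu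
  have hF : ∀ t, IntSeries.HasValueAt (lineSubst a (transpose G)) (u ^ t - 1) (x t) := fun t ↦
    (hasValueAt_lineSubst_transpose_iff G ha' (hnode t) (x t)).mpr (hx t)
  have hF' : ∀ t, IntSeries.HasValueAt (lineSubst a (transpose G')) (u ^ t - 1) (c * d ^ t * x t) :=
    fun t ↦ (hasValueAt_lineSubst_transpose_iff G' ha' (hnode t) _).mpr (hx' t)
  have h00 : x t₀ ≠ 0 := by rwa [(hx t₀).unique hx₀]
  obtain ⟨z, -, hdz⟩ := map_eq_C_mul_binomPow_mul_of_values_proportional (x' := fun t ↦ c * d ^ t * x t)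
    hu hroot hc hd hF hF' (fun _ ↦ rfl) h00
  exact ⟨z, hdz⟩

/-- In particular `‖d‖ = 1`. [cite: deShalit1987, II.4.12 Remarks (iii)–(iv) (p. 66–67)] [cite: Koblitz1984, Ch. IV §1] -/
theorem norm_eq_one_of_torsion_nodes {G G' : PowerSeries (PowerSeries (PadicComplexInt p))}
    {u c d : ℂ_[p]} (hu : ‖u - 1‖ < 1) (hroot : ∀ n : ℕ, 0 < n → u ^ n ≠ 1) (hc : c ≠ 0) (hd : d ≠ 0)
    (n₀ : ℕ)
    (h : ∀ (t n : ℕ) (ζ : ℂ_[p]), n₀ < n → IsPrimitiveRoot ζ (p ^ n) →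
      ∃ x : ℂ_[p], IntSeries.HasValueAt₂ G (u ^ t - 1) (ζ - 1) x ∧
        IntSeries.HasValueAt₂ G' (u ^ t - 1) (ζ - 1) (c * d ^ t * x))
    (hG0 : G ≠ 0) : ‖d‖ = 1 := by
  obtain ⟨z, hz⟩ := exists_onePlusPow_eq_of_torsion_nodes hu hroot hc hd n₀ h hG0
  have hlt := norm_onePlusPow_sub_one_lt z hu
  rw [← hz] at hlt
  have hh := IsUltrametricDist.norm_add_eq_max_of_norm_ne_norm (x := d - 1) (y := (1 : ℂ_[p]))
    (by rw [norm_one]; exact hlt.ne)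
  rw [sub_add_cancel, norm_one] at hh
  rw [hh]
  exact max_eq_right hlt.le

/-! ### §3. The identity `G' = c·(1+T₁)^z·G` and the equality of ideals -/

/-- **`G' = c·(1+T₁)^z·G`.** In the situation of `exists_onePlusPow_eq_of_torsion_nodes`, if the constant
ratio `c` is integral (`c ∈ 𝒪_{ℂ_p}`), then for some `z ∈ ℤ_p` with `d = u^z`:
`G' = (C c · (1+T)^z)(T₁) · G` in `𝒪_{ℂ_p}⟦T₁⟧⟦T₂⟧`. Proof: with `U = C c · binomPow z`, the transposed
difference `G'ᵗ − C U · Gᵗ` vanishes at every point `(ζ − 1, uᵗ − 1)` of the (transposed) set — on the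
line `T₂ = ζ − 1` its value is `c·dᵗ·x − (c·(uᵗ)^z)·x = 0` by one-variable multiplicativity of values
(`lineSubst_C_mul`, `HasValueAt.mul`, `onePlusPow_pow_sub_one`) — hence is `0`
(`eq_zero_of_zeros₂_torsion_fst`); transpose back (`transpose_C_mul`).
[cite: deShalit1987, II.4.12 Remarks (iii)–(iv) (p. 66–67), II.4.17 (51)–(54) (p. 77–78)]
[cite: Gouvea1993PadicNumbers, §5.9 Lemma 5.9.1 and Problem 194] -/
theorem eq_map_C_mul_binomPow_mul_of_torsion_nodes {G G' : PowerSeries (PowerSeries (PadicComplexInt p))}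
    {u d : ℂ_[p]} {c : PadicComplexInt p} (hu : ‖u - 1‖ < 1) (hroot : ∀ n : ℕ, 0 < n → u ^ n ≠ 1)
    (hc : (c : ℂ_[p]) ≠ 0) (hd : d ≠ 0) (n₀ : ℕ)
    (h : ∀ (t n : ℕ) (ζ : ℂ_[p]), n₀ < n → IsPrimitiveRoot ζ (p ^ n) →
      ∃ x : ℂ_[p], IntSeries.HasValueAt₂ G (u ^ t - 1) (ζ - 1) x ∧
        IntSeries.HasValueAt₂ G' (u ^ t - 1) (ζ - 1) ((c : ℂ_[p]) * d ^ t * x))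
    (hG0 : G ≠ 0) :
    ∃ z : ℤ_[p], d = onePlusPow z (u - 1) ∧
      G' = (PowerSeries.C c * binomPow z).map (PowerSeries.C (R := PadicComplexInt p)) * G := by
  obtain ⟨z, hz⟩ := exists_onePlusPow_eq_of_torsion_nodes hu hroot hc hd n₀ h hG0
  refine ⟨z, hz, ?_⟩
  have hu1 : u ≠ 1 := fun h1 ↦ hroot 1 Nat.one_pos (by rw [pow_one, h1])
  have hϖ0 : u - 1 ≠ 0 := sub_ne_zero.mpr hu1
  have hnode : ∀ t : ℕ, ‖u ^ t - 1‖ < 1 := fun t ↦ (norm_pow_sub_one_le hu t).trans_lt hu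
  set U : PowerSeries (PadicComplexInt p) := PowerSeries.C c * binomPow z with hU
  -- the transposed difference vanishes on the (transposed) set
  have hH : transpose G' - PowerSeries.C U * transpose G = 0 := by
    refine eq_zero_of_zeros₂_torsion_fst hϖ0 hu (infinite_setOf_node hu hroot)
      (by rintro y ⟨t, ht⟩; rw [ht]; exact norm_pow_sub_one_le hu t) n₀ fun n ζ hn hζ ↦ ?_
    rintro y ⟨t, ht⟩
    rw [ht]
    obtain ⟨x, hx, hx'⟩ := h t n ζ hn hζ
    have hζ1 : ‖ζ - 1‖ < 1 := norm_sub_one_lt_one_of_isPrimitiveRoot_pow hζ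
    set a : PadicComplexInt p := ⟨ζ - 1, mem_padicComplexInt_iff.mpr hζ1.le⟩ with ha
    have ha' : ‖(a : ℂ_[p])‖ < 1 := hζ1
    -- value of `G'ᵗ`
    have h1 : IntSeries.HasValueAt₂ (transpose G') (ζ - 1) (u ^ t - 1) ((c : ℂ_[p]) * d ^ t * x) :=
      (hasValueAt₂_transpose_iff G' (ζ - 1) (u ^ t - 1) _).mpr hx'
    -- value of `C U · Gᵗ`, through its line `T₂ = ζ − 1`
    have h2 : IntSeries.HasValueAt₂ (PowerSeries.C U * transpose G) (ζ - 1) (u ^ t - 1)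
        ((c : ℂ_[p]) * d ^ t * x) := by
      have hL : IntSeries.HasValueAt (lineSubst a (transpose G)) (u ^ t - 1) x :=
        (hasValueAt_lineSubst_transpose_iff G ha' (hnode t) x).mpr hx
      have hUv : IntSeries.HasValueAt U (u ^ t - 1) ((c : ℂ_[p]) * d ^ t) := by
        have := hasValueAt_C_mul_binomPow c z (hnode t)
        rwa [onePlusPow_pow_sub_one z hu t, ← hz] at this
      have hprod := hUv.mul (hnode t) hL
      rw [← lineSubst_C_mul (transpose G) U ha'] at hprod
      exact (hasValueAt_lineSubst_iff _ ha' (hnode t) _).mp hprod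
    simpa using h1.sub h2
  -- transpose back
  have hT : transpose G' = PowerSeries.C U * transpose G := sub_eq_zero.mp hH
  calc G' = transpose (transpose G') := (transpose_transpose G').symm
    _ = transpose (PowerSeries.C U * transpose G) := by rw [hT]
    _ = U.map (PowerSeries.C (R := PadicComplexInt p)) * transpose (transpose G) := transpose_C_mul _ U
    _ = U.map (PowerSeries.C (R := PadicComplexInt p)) * G := by rw [transpose_transpose]

/-- **`(G') = (G)`.** In the situation of `exists_onePlusPow_eq_of_torsion_nodes`, if the constant ratio has
`‖c‖ = 1`, then `G` and `G'` generate the same ideal of `𝒪_{ℂ_p}⟦T₁⟧⟦T₂⟧` (`G' = c·(1+T₁)^z·G` with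
`c·(1+T₁)^z` a unit). This is the `j = 0` two-variable Katz period rigidity in abstract form.
[cite: deShalit1987, II.4.12 Remarks (iii)–(iv) (p. 66–67), II.4.17 (51)–(54) (p. 77–78)]
[cite: Gouvea1993PadicNumbers, §5.9 Lemma 5.9.1 and Problem 194] -/
theorem span_eq_span_of_torsion_nodes {G G' : PowerSeries (PowerSeries (PadicComplexInt p))}
    {u c d : ℂ_[p]} (hu : ‖u - 1‖ < 1) (hroot : ∀ n : ℕ, 0 < n → u ^ n ≠ 1) (hc1 : ‖c‖ = 1) (hd : d ≠ 0)
    (n₀ : ℕ)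
    (h : ∀ (t n : ℕ) (ζ : ℂ_[p]), n₀ < n → IsPrimitiveRoot ζ (p ^ n) →
      ∃ x : ℂ_[p], IntSeries.HasValueAt₂ G (u ^ t - 1) (ζ - 1) x ∧
        IntSeries.HasValueAt₂ G' (u ^ t - 1) (ζ - 1) (c * d ^ t * x))
    (hG0 : G ≠ 0) : Ideal.span {G'} = Ideal.span {G} := by
  have hc : c ≠ 0 := fun h0 ↦ by rw [h0, norm_zero] at hc1; exact zero_ne_one hc1
  set c' : PadicComplexInt p := ⟨c, mem_padicComplexInt_iff.mpr hc1.le⟩ with hc'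
  obtain ⟨z, -, hG'⟩ := eq_map_C_mul_binomPow_mul_of_torsion_nodes (c := c') hu hroot hc hd n₀ h hG0
  have hcu : IsUnit c' := isUnit_padicComplexInt_iff.mpr hc1
  have hunit : IsUnit ((PowerSeries.C c' * binomPow z).map (PowerSeries.C (R := PadicComplexInt p))) :=
    ((hcu.map _).mul (isUnit_binomPow z)).map _
  rw [hG']
  exact Ideal.span_singleton_mul_left_unit hunit G

end Literature.NumberTheory.EllipticCurves.IntSeries

end
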